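import Summits.HodgeConjecture.HodgeConjecture.Theorems.NikulinTwinTransportRealMultiplicationCore
import Summits.HodgeConjecture.HodgeConjecture.Theorems.NikulinTwinTransportTwinSimilitudeAlgebraic
import Summits.HodgeConjecture.HodgeConjecture.Theorems.NikulinTwinTransportTwinSimilitudeAlgebraicMarkings
import Literature.AlgebraicGeometry.Surfaces.K3Marking
import Literature.AlgebraicGeometry.Surfaces.K3HodgeTypes
import Literature.AlgebraicGeometry.HodgeTheory.SupportedClassesHodgeConiveau

/-!
# Route NikulinTwinTransport · `RealMultiplicationSqrtTwoAlgebraic` (stmt-HodgeConjecture-13679) —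
# real multiplication by `√2` is algebraic, granted X = Sim₂(K3) at the pair `(S, S)` and divisor
# correspondences

THE REDUCTION (`realMultiplicationSqrtTwoAlgebraic_of_twinSimilitudeAlgebraic`, concluding the route
decl `RealMultiplicationSqrtTwoAlgebraic` BY NAME). Let `e` be rational, type-preserving,
cup-self-adjoint, `e|_{NS} = 0`, `e² = 2` on `NS^⊥` (`NS := algebraicClasses S 1`). With a marking
`η` of `S` (`Huybrechts_K3_marking_exists`), `exists_ratCorrection` (sibling file
`NikulinTwinTransportRealMultiplicationCore`: Witt's extension theorem over `ℚ`, PROVED in the tree,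
plus the explicit lattice `2`-similitude) produces `ν̃ x = Σᵢ (ηx.aᵢ) η⁻¹bᵢ` with
`η⁻¹aᵢ, η⁻¹bᵢ ∈ NS` such that `Ξ := e + ν̃` restricts on `Λ_ℚ` to a rational `2`-similitude `ξ`.
Then `Ξ` is rational (`isRationalClass_add_correction`), doubles cup products
(`cupProduct_add_correction`) and preserves every Hodge type (`isOfHodgeType_add_correction`: by
`Huybrechts_K3_hodgeTypes_H2`, `H^{2,0} = ℂσ`, `H^{0,2} = ℂσ̄`, `H^{1,1} = ⟨σ,σ̄⟩^⊥`, and the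
divisor classes `η⁻¹aᵢ, η⁻¹bᵢ` are of type `(1,1)`, hence orthogonal to `σ, σ̄`). So X — the
route's target `TwinSimilitudeAlgebraic`, used only for `S' = S`, `p' = p` — makes `Ξ = [γ]_*`
algebraic; each rank-one piece `x ↦ (x.η⁻¹aᵢ) η⁻¹bᵢ` is a DIVISOR CORRESPONDENCE, algebraic by
hypothesis (D); hence `e = Ξ − ν̃` is algebraic (`induced_sub`, `induced_sum`).

HYPOTHESES of the reduction, all spelled in the route's vocabulary (no new definitions):
(X) `TwinSimilitudeAlgebraic` (item stmt-HodgeConjecture-13674); the named facts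
`Huybrechts_K3_marking_exists`, `Huybrechts_K3_hodgeTypes_H2`; (hN11) algebraic divisor classes
on projective K3 surfaces are of type `(1,1)` — `isOfHodgeType_oneOne_of_mem_algebraicClasses`
derives it from the named fact `Grothendieck1969_supportedClasses_le_hodgeConiveau`; and ONE inline
formal debt, (D) DIVISOR CORRESPONDENCES: for `a, b ∈ N¹H²(S)` some algebraic `γ ∈ N²H⁴(S × S)`
acts as `x ↦ (x.a) b` (`γ = c · b × a`, Fulton, *Intersection Theory* §16.1; on the tree's carriers
this needs the projection formula and Gysin base change for `S × S → S`, not yet in the tree — a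
planner may file (D) verbatim as the glue's child). NOT needed, in contrast with the route's own
glue `RealMultiplicationGlue` (`e = Φ ∘ ψᵗ − (ν ⊕ 0) ∘ ψᵗ`): the universal twin, Buskin's theorem,
composition / transpose of correspondences, Lefschetz `(1,1)` —
`realMultiplicationGlue_of_divisorCorrespondences` records that the glue item
(stmt-HodgeConjecture-13681) follows from (D) and the three named facts alone.

What this file does NOT do: prove X (open: Varesco 2023 Thm. 2.1 covers the Nikulin locus only) or
(D). Sources: Varesco, Math. Z. 305 (2023) Thm. 2.1, Rem. 2.2; Huybrechts, Comment. Math. Helv. 94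
(2019) §1; Huybrechts, *Lectures on K3 Surfaces* Ch. 6 Prop. 1.2; Fulton §16.1. Prover seat
prover-HodgeConjecture-route-HodgeConjecture-NikulinTwinTransport-3.
-/

noncomputable section

namespace Summit.HodgeConjecture.HodgeConjecture.Theorems.NikulinTwinTransport

open scoped Manifold
open CategoryTheory MonoidalCategory
open Literature.AlgebraicGeometry.Motives Literature.AlgebraicGeometry.HodgeTheory
open Literature.AlgebraicGeometry.Surfaces Literature.Geometry.Kaehler
open Literature.AlgebraicTopology.SingularHomology

section Marked

variable {S : SchemeOver ℂ}

/-! ### The corrected endomorphism `Ξ = e + ν̃` satisfies the hypotheses of X at the pair `(S, S)` -/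

/-- `η ∘ (e + ν̃) ∘ η⁻¹` restricts to `ξ` on `Λ_ℚ` (bookkeeping form of the last clause of
`exists_ratCorrection`). [folklore] -/
theorem marking_add_correction_ratCast
    (η : complexBetti S (2 * 1) ≃ₗ[ℂ] (K3Index → ℂ))
    (e ν : complexBetti S (2 * 1) →ₗ[ℂ] complexBetti S (2 * 1))
    {m : ℕ} (a b : Fin m → K3Index → ℚ) (ξ : Module.End ℚ (K3Index → ℚ))
    (hν : ∀ x, ν x = ∑ i, k3Form (η x) (fun j => (a i j : ℂ)) • η.symm (fun j => (b i j : ℂ)))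
    (hKB : ∀ u : K3Index → ℚ,
      η (e (η.symm fun j => (u j : ℂ))) +
          ∑ i, k3Form (fun j => (u j : ℂ)) (fun j => (a i j : ℂ)) • (fun j => (b i j : ℂ)) =
        fun j => (ξ u j : ℂ))
    (u : K3Index → ℚ) :
    η ((e + ν) (η.symm fun j => (u j : ℂ))) = fun j => (ξ u j : ℂ) := by
  rw [← hKB u, LinearMap.add_apply, map_add, hν, map_sum, LinearEquiv.apply_symm_apply]
  congr 1
  refine Finset.sum_congr rfl fun i _ => ?_
  rw [map_smul, LinearEquiv.apply_symm_apply]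

/-- **`Ξ = e + ν̃` multiplies cup products by `2`** (the similitude clause of X, with the marking's
generator `p₀` of `H⁴` on both sides): `η Ξ η⁻¹` restricts on `Λ_ℚ` to the rational `2`-similitude
`ξ`, hence is a `2`-similitude of `(Λ_ℂ, k3Form)` (`k3Form_of_ratRestriction`). [folklore] -/
theorem cupProduct_add_correction
    (η : complexBetti S (2 * 1) ≃ₗ[ℂ] (K3Index → ℂ)) (p₀ : complexBetti S (2 * 2)) (hp₀ : p₀ ≠ 0)
    (hηcup : ∀ a b : complexBetti S (2 * 1),
      cupProduct (rfl : 2 * 1 + 2 * 1 = 2 * 2) a b = k3Form (η a) (η b) • p₀)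
    (e ν : complexBetti S (2 * 1) →ₗ[ℂ] complexBetti S (2 * 1))
    {m : ℕ} (a b : Fin m → K3Index → ℚ) (ξ : Module.End ℚ (K3Index → ℚ))
    (hν : ∀ x, ν x = ∑ i, k3Form (η x) (fun j => (a i j : ℂ)) • η.symm (fun j => (b i j : ℂ)))
    (hKB : ∀ u : K3Index → ℚ,
      η (e (η.symm fun j => (u j : ℂ))) +
          ∑ i, k3Form (fun j => (u j : ℂ)) (fun j => (a i j : ℂ)) • (fun j => (b i j : ℂ)) =
        fun j => (ξ u j : ℂ))
    (hξ : ∀ u v, k3FormRat (ξ u) (ξ v) = 2 * k3FormRat u v)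
    (x y : complexBetti S (2 * 1)) (c : ℂ)
    (hxy : cupProduct (rfl : 2 * 1 + 2 * 1 = 2 * 2) x y = c • p₀) :
    cupProduct (rfl : 2 * 1 + 2 * 1 = 2 * 2) ((e + ν) x) ((e + ν) y) = (2 * c) • p₀ := by
  have hΛ : ∀ u : K3Index → ℚ, (η.toLinearMap ∘ₗ (e + ν) ∘ₗ η.symm.toLinearMap) (fun j => (u j : ℂ)) =
      fun j => (ξ u j : ℂ) := fun u => by
    simpa only [LinearMap.coe_comp, LinearEquiv.coe_coe, Function.comp_apply] using
      marking_add_correction_ratCast η e ν a b ξ hν hKB u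
  have h2 := k3Form_of_ratRestriction _ ξ hΛ 2 hξ (η x) (η y)
  simp only [LinearMap.coe_comp, LinearEquiv.coe_coe, Function.comp_apply,
    LinearEquiv.symm_apply_apply, Rat.cast_ofNat] at h2
  rw [hηcup] at hxy ⊢
  have hc : k3Form (η x) (η y) = c := smul_left_injective ℂ hp₀ hxy
  rw [h2, hc]

/-- **`Ξ = e + ν̃` is rational**: under the marking the rational classes are exactly `Λ_ℚ`
(`isRationalClass_iff_of_marking`), on which `η Ξ η⁻¹ = ξ`. [folklore] -/
theorem isRationalClass_add_correction (hS : IsK3Surface S)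
    (η : complexBetti S (2 * 1) ≃ₗ[ℂ] (K3Index → ℂ))
    (hηint : ∀ c : complexBetti S (2 * 1), IsIntegralClass c ↔ ∃ v : K3Index → ℤ, η c = fun i => (v i : ℂ))
    (e ν : complexBetti S (2 * 1) →ₗ[ℂ] complexBetti S (2 * 1))
    {m : ℕ} (a b : Fin m → K3Index → ℚ) (ξ : Module.End ℚ (K3Index → ℚ))
    (hν : ∀ x, ν x = ∑ i, k3Form (η x) (fun j => (a i j : ℂ)) • η.symm (fun j => (b i j : ℂ)))
    (hKB : ∀ u : K3Index → ℚ,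
      η (e (η.symm fun j => (u j : ℂ))) +
          ∑ i, k3Form (fun j => (u j : ℂ)) (fun j => (a i j : ℂ)) • (fun j => (b i j : ℂ)) =
        fun j => (ξ u j : ℂ))
    (x : complexBetti S (2 * 1)) (hx : IsRationalClass x) : IsRationalClass ((e + ν) x) := by
  obtain ⟨u, hu⟩ := (isRationalClass_iff_of_marking hS η hηint x).1 hx
  have hx' : x = η.symm fun j => (u j : ℂ) := by rw [← hu, LinearEquiv.symm_apply_apply]
  refine (isRationalClass_iff_of_marking hS η hηint _).2 ⟨ξ u, ?_⟩
  rw [hx', marking_add_correction_ratCast η e ν a b ξ hν hKB u]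

/-- **`Ξ = e + ν̃` preserves every Hodge type** (granted the K3 description of the types on `H²`:
`H^{2,0} = ℂσ`, `H^{0,2} = ℂσ̄`, `H^{1,1} = ⟨σ, σ̄⟩^⊥`, with `σ = η⁻¹x₀`, `σ̄ = η⁻¹x̄₀`): `ν̃` kills
`σ` and `σ̄` and takes values in classes orthogonal to `σ, σ̄`, because the divisor classes
`η⁻¹aᵢ, η⁻¹bᵢ` are orthogonal to `σ` and `σ̄`. [cite: Huybrechts2016K3, Ch. 6 Prop. 1.2] -/
theorem isOfHodgeType_add_correction (hS : IsK3Surface S)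
    (η : complexBetti S (2 * 1) ≃ₗ[ℂ] (K3Index → ℂ)) (p₀ : complexBetti S (2 * 2))
    (hηcup : ∀ a b : complexBetti S (2 * 1),
      cupProduct (rfl : 2 * 1 + 2 * 1 = 2 * 2) a b = k3Form (η a) (η b) • p₀)
    (x₀ : K3Index → ℂ)
    (h1 : ∀ c : complexBetti S (2 * 1), IsOfHodgeType 2 S (2 * 1) 2 0 c ↔ ∃ t : ℂ, c = t • η.symm x₀)
    (h2 : ∀ c : complexBetti S (2 * 1),
      IsOfHodgeType 2 S (2 * 1) 0 2 c ↔ ∃ t : ℂ, c = t • η.symm (star x₀))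
    (h3 : ∀ c : complexBetti S (2 * 1), IsOfHodgeType 2 S (2 * 1) 1 1 c ↔
      cupProduct (rfl : 2 * 1 + 2 * 1 = 2 * 2) c (η.symm x₀) = 0 ∧
        cupProduct (rfl : 2 * 1 + 2 * 1 = 2 * 2) c (η.symm (star x₀)) = 0)
    (e ν : complexBetti S (2 * 1) →ₗ[ℂ] complexBetti S (2 * 1))
    (he_type : ∀ (i j : ℕ) x, IsOfHodgeType 2 S (2 * 1) i j x → IsOfHodgeType 2 S (2 * 1) i j (e x))
    {m : ℕ} (a b : Fin m → K3Index → ℚ)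
    (hν : ∀ x, ν x = ∑ i, k3Form (η x) (fun j => (a i j : ℂ)) • η.symm (fun j => (b i j : ℂ)))
    (ha : ∀ i, k3Form (fun j => (a i j : ℂ)) x₀ = 0 ∧ k3Form (fun j => (a i j : ℂ)) (star x₀) = 0)
    (hb : ∀ i, k3Form (fun j => (b i j : ℂ)) x₀ = 0 ∧ k3Form (fun j => (b i j : ℂ)) (star x₀) = 0) :
    ∀ (i j : ℕ) (y : complexBetti S (2 * 1)),
      IsOfHodgeType 2 S (2 * 1) i j y → IsOfHodgeType 2 S (2 * 1) i j ((e + ν) y) := by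
  have hν0 : ν (η.symm x₀) = 0 := by
    rw [hν, LinearEquiv.apply_symm_apply]
    refine Finset.sum_eq_zero fun i _ => ?_
    rw [k3Form_comm, (ha i).1, zero_smul]
  have hν0' : ν (η.symm (star x₀)) = 0 := by
    rw [hν, LinearEquiv.apply_symm_apply]
    refine Finset.sum_eq_zero fun i _ => ?_
    rw [k3Form_comm, (ha i).2, zero_smul]
  intro i j y hy
  by_cases hij : i + j = 2 * 1
  · obtain ⟨rfl, rfl⟩ | ⟨rfl, rfl⟩ | ⟨rfl, rfl⟩ :
        (i = 2 ∧ j = 0) ∨ (i = 0 ∧ j = 2) ∨ (i = 1 ∧ j = 1) := by omega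
    · obtain ⟨t, ht⟩ := (h1 y).1 hy
      rw [LinearMap.add_apply, show ν y = 0 by rw [ht, map_smul, hν0, smul_zero], add_zero]
      exact he_type 2 0 y hy
    · obtain ⟨t, ht⟩ := (h2 y).1 hy
      rw [LinearMap.add_apply, show ν y = 0 by rw [ht, map_smul, hν0', smul_zero], add_zero]
      exact he_type 0 2 y hy
    · obtain ⟨he1, he2⟩ := (h3 (e y)).1 (he_type 1 1 y hy)
      refine (h3 _).2 ⟨?_, ?_⟩
      · rw [LinearMap.add_apply, map_add, LinearMap.add_apply, he1, zero_add, hν, map_sum,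
          LinearMap.sum_apply]
        refine Finset.sum_eq_zero fun k _ => ?_
        rw [map_smul, LinearMap.smul_apply, hηcup, LinearEquiv.apply_symm_apply,
          LinearEquiv.apply_symm_apply, (hb k).1, zero_smul, smul_zero]
      · rw [LinearMap.add_apply, map_add, LinearMap.add_apply, he2, zero_add, hν, map_sum,
          LinearMap.sum_apply]
        refine Finset.sum_eq_zero fun k _ => ?_
        rw [map_smul, LinearMap.smul_apply, hηcup, LinearEquiv.apply_symm_apply,
          LinearEquiv.apply_symm_apply, (hb k).2, zero_smul, smul_zero]
  · obtain rfl := isOfHodgeType_eq_zero_of_add_ne hy hij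
    rw [map_zero]
    obtain ⟨A⟩ := hS.nonempty_hodgeModel
    exact IsOfHodgeType.zero A _ _ _

end Marked

/-! ### Algebraic divisor classes are of type `(1,1)` (from Grothendieck's coniveau fact) -/

/-- **Algebraic classes of codimension `1` on a projective K3 surface are of Hodge type `(1,1)`**,
from the named fact `Grothendieck1969_supportedClasses_le_hodgeConiveau` (`N¹H² ⊆ H^{1,1}` in
every Hodge model; Grothendieck 1969 p. 300, Voisin I Prop. 11.20). [cite: GrothendieckTopology1969, p. 300]
[cite: VoisinHodgeI2002, Prop. 11.20] -/
theorem isOfHodgeType_oneOne_of_mem_algebraicClasses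
    (hG : Grothendieck1969_supportedClasses_le_hodgeConiveau) {S : SchemeOver ℂ} (hS : IsK3Surface S)
    {d : complexBetti S (2 * 1)} (hd : d ∈ algebraicClasses S 1) : IsOfHodgeType 2 S (2 * 1) 1 1 d := by
  obtain ⟨A⟩ := hS.nonempty_hodgeModel
  have h : A.pullback (2 * 1) d ∈ A.hodgeConiveau (2 * 1) 1 := hG hS.1 A (2 * 1) 1 ⟨d, hd, rfl⟩
  have hle : A.hodgeConiveau (2 * 1) 1 ≤ A.hodgePQ (2 * 1) 1 1 := by
    refine iSup_le fun p => iSup_le fun q => iSup_le fun hpq => iSup_le fun hp => iSup_le fun hq => ?_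
    obtain ⟨rfl, rfl⟩ : p = 1 ∧ q = 1 := by omega
    exact le_rfl
  exact ⟨A, hle h⟩

/-! ### The reduction -/

/-- **Real multiplication by `√2` on a projective K3 surface is algebraic, granted X = Sim₂(K3) at
the pair `(S, S)` and divisor correspondences.** Hypotheses: (X) the route's target
`TwinSimilitudeAlgebraic` (used only for `S′ = S`); the named facts `Huybrechts_K3_marking_exists`
(markings) and `Huybrechts_K3_hodgeTypes_H2` (Hodge types of `H²(K3)`); (hN11) algebraic divisor
classes on projective K3 surfaces are of type `(1,1)` (`isOfHodgeType_oneOne_of_mem_algebraicClasses`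
derives it from `Grothendieck1969_supportedClasses_le_hodgeConiveau`); (D) DIVISOR CORRESPONDENCES:
for `a, b ∈ N¹H²(S)` there is an algebraic `γ ∈ N²H⁴(S × S)` acting as `x ↦ (x.a) b`
(`γ = b × a`, Fulton §16.1; formal debt on the tree's carriers — Gysin base change / projection
formula — hence a hypothesis). PROOF: with a marking `η`, `e` becomes a rational self-adjoint `ε`
of `Λ_ℚ` killing `NS_ℚ` with `ε² = 2` on `T = NS^⊥`; by Witt's extension theorem (tree:
`Witt_isometry_extension_holds`) applied to `ε|_T : (T, 2q) → (Λ_ℚ, q)` along the lattice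
`2`-similitude `Λ_ℚ(2) ≅ Λ_ℚ` (`exists_twoSimilitude_k3FormRat`), there is a rational `2`-similitude
`ξ = ε + g` of `Λ_ℚ` with `g` supported on `NS` and killing `T` (`exists_ratCorrection`); `g` is a
sum of rank-one maps `x ↦ (x.aᵢ) bᵢ`, `aᵢ, bᵢ ∈ NS_ℚ`. Then `Ξ = e + ν̃` (`ν̃` the same sum on
`H²`) is rational, preserves every Hodge type (the `aᵢ, bᵢ` are orthogonal to `σ, σ̄`) and doubles
cup products, so `Ξ = [γ]_*` is algebraic by X; each `x ↦ (x.aᵢ) bᵢ` is algebraic by (D); hence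
`e = Ξ − ν̃` is algebraic. (Simpler than the route's factorisation `e = Φ ∘ ψᵗ − (ν ⊕ 0) ∘ ψᵗ`: no
twin, no Buskin, no composition or transpose of correspondences, no Lefschetz `(1,1)`.)
[cite: Varesco2023, Thm. 2.1 and Rem. 2.2] [cite: Huybrechts2019, §1] [cite: Fulton1998, §16.1] -/
theorem realMultiplicationSqrtTwoAlgebraic_of_twinSimilitudeAlgebraic
    (hX : Theses.NikulinTwinTransport.TwinSimilitudeAlgebraic)
    (hmark : Huybrechts_K3_marking_exists) (hHT : Huybrechts_K3_hodgeTypes_H2)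
    (hN11 : ∀ (S : SchemeOver ℂ), IsK3Surface S →
      ∀ d ∈ algebraicClasses S 1, IsOfHodgeType 2 S (2 * 1) 1 1 d)
    (hD : ∀ (μ : OrientationFamily), μ.HasPoincareDuality →
      ∀ (S : SchemeOver ℂ)
        (hS : (IsSmoothProjective 2 S ∧ Subsingleton (structureSheafCohomology S.left 1) ∧
          ∃ (A : HodgeModel 2 S) (η : MForm 𝓘(ℝ, A.model) A.carrier ℂ 2),
            IsHolomorphicInCharts η ∧ ∀ x, η x ≠ 0))
        (p : complexBetti S (2 * 2)),
        (IsIntegralClass p ∧ ∀ q : complexBetti S (2 * 2), IsIntegralClass q → ∃ n : ℤ, q = n • p) →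
        ∀ a ∈ algebraicClasses S 1, ∀ b ∈ algebraicClasses S 1,
          ∃ γ ∈ algebraicClasses (S ⊗ S) 2, ∀ (x : complexBetti S (2 * 1)) (t : ℂ),
            cupProduct (rfl : 2 * 1 + 2 * 1 = 2 * 2) x a = t • p →
              complexGysin μ (IsSmoothProjective.tensor_holds hS.1 hS.1) hS.1
                  (SemiCartesianMonoidalCategory.fst S S)
                  (rfl : 2 * 1 + 2 * 2 + 2 * 2 = 2 * 1 + 2 * (2 + 2))
                  (cupProduct (rfl : 2 * 1 + 2 * 2 = 2 * 1 + 2 * 2)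
                    (complexBetti.map (SemiCartesianMonoidalCategory.snd S S) (2 * 1) x) γ) =
                t • b) :
    Theses.NikulinTwinTransport.RealMultiplicationSqrtTwoAlgebraic := by
  intro μ hμ S hS e he_rat he_type he_adj he_N he_T
  -- a marking of `S`
  obtain ⟨η, p₀, x₀, hp₀, ⟨hp₀int, hp₀gen, hηint, hηcup, h20, -⟩, ⟨-, hxpos, -⟩⟩ := hmark S hS
  -- the rational correction (Witt)
  obtain ⟨m, a, b, ξ, ha, hb, hξ, hKB⟩ :=
    exists_ratCorrection hS η p₀ hp₀ hηint hηcup e he_rat he_adj he_N he_T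
  -- the correction `ν̃ = Σᵢ (η(·).aᵢ) η⁻¹bᵢ`, a sum of rank-one maps
  set ψ : Fin m → (complexBetti S (2 * 1) →ₗ[ℂ] complexBetti S (2 * 1)) := fun i =>
    ((k3FormC.flip fun j => (a i j : ℂ)) ∘ₗ η.toLinearMap).smulRight (η.symm fun j => (b i j : ℂ))
    with hψdef
  have hψ : ∀ i x, ψ i x = k3Form (η x) (fun j => (a i j : ℂ)) • η.symm (fun j => (b i j : ℂ)) := by
    intro i x
    rw [hψdef]
    change ((k3FormC.flip fun j => (a i j : ℂ)) ∘ₗ η.toLinearMap) x • η.symm (fun j => (b i j : ℂ)) = _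
    rw [LinearMap.comp_apply, LinearEquiv.coe_coe, LinearMap.BilinForm.flip_apply, k3FormC_apply]
  set ν : complexBetti S (2 * 1) →ₗ[ℂ] complexBetti S (2 * 1) := ∑ i, ψ i with hνdef
  have hν : ∀ x, ν x = ∑ i, k3Form (η x) (fun j => (a i j : ℂ)) • η.symm (fun j => (b i j : ℂ)) := by
    intro x
    rw [hνdef, LinearMap.sum_apply]
    exact Finset.sum_congr rfl fun i _ => hψ i x
  -- the `(2,0)`-class `σ = η⁻¹ x₀` and the Hodge types of `H²(S)`
  have hσ0 : η.symm x₀ ≠ 0 := fun h0 =>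
    ne_zero_of_star_self_re_pos hxpos (by simpa using congrArg η h0)
  obtain ⟨h1, h2, h3⟩ := hHT S hS (η.symm x₀) h20 hσ0
  rw [conjClass_marking_symm η hηint] at h2 h3
  -- divisor classes are orthogonal to `σ` and `σ̄`
  have horth : ∀ w : K3Index → ℚ, η.symm (fun j => (w j : ℂ)) ∈ algebraicClasses S 1 →
      k3Form (fun j => (w j : ℂ)) x₀ = 0 ∧ k3Form (fun j => (w j : ℂ)) (star x₀) = 0 := by
    intro w hw
    obtain ⟨hw1, hw2⟩ := (h3 _).1 (hN11 S hS _ hw)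
    rw [hηcup, LinearEquiv.apply_symm_apply, LinearEquiv.apply_symm_apply, smul_eq_zero] at hw1 hw2
    exact ⟨hw1.resolve_right hp₀, hw2.resolve_right hp₀⟩
  -- X at the pair `(S, S)` for `Ξ = e + ν̃`
  obtain ⟨γ, hγ, hΞγ⟩ := hX μ hμ S S hS hS p₀ p₀ ⟨hp₀int, hp₀gen⟩ ⟨hp₀int, hp₀gen⟩ (e + ν)
    (isRationalClass_add_correction hS η hηint e ν a b ξ hν hKB)
    (isOfHodgeType_add_correction hS η p₀ hηcup x₀ h1 h2 h3 e ν he_type a b hν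
      (fun i => horth _ (ha i)) (fun i => horth _ (hb i)))
    (cupProduct_add_correction η p₀ hp₀ hηcup e ν a b ξ hν hKB hξ)
  -- the rank-one pieces are divisor correspondences, algebraic by (D)
  have hψind : ∀ i ∈ (Finset.univ : Finset (Fin m)), ∃ γ' ∈ algebraicClasses (S ⊗ S) 2,
      ∀ x : complexBetti S (2 * 1), ψ i x =
        complexGysin μ (IsSmoothProjective.tensor_holds hS.1 hS.1) hS.1
          (SemiCartesianMonoidalCategory.fst S S)
          (rfl : 2 * 1 + 2 * 2 + 2 * 2 = 2 * 1 + 2 * (2 + 2))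
          (cupProduct (rfl : 2 * 1 + 2 * 2 = 2 * 1 + 2 * 2)
            (complexBetti.map (SemiCartesianMonoidalCategory.snd S S) (2 * 1) x) γ') := by
    intro i _
    obtain ⟨γ', hγ', hγ'eq⟩ := hD μ hμ S hS p₀ ⟨hp₀int, hp₀gen⟩ _ (ha i) _ (hb i)
    refine ⟨γ', hγ', fun x => ?_⟩
    rw [hψ i x]
    exact (hγ'eq x _ (by rw [hηcup, LinearEquiv.apply_symm_apply])).symm
  have hνind := induced_sum (IsSmoothProjective.tensor_holds hS.1 hS.1) hS.1
    (rfl : 2 * 1 + 2 * 2 = 2 * 1 + 2 * 2) (rfl : 2 * 1 + 2 * 2 + 2 * 2 = 2 * 1 + 2 * (2 + 2))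
    Finset.univ ψ hψind
  have h := induced_sub (IsSmoothProjective.tensor_holds hS.1 hS.1) hS.1
    (rfl : 2 * 1 + 2 * 2 = 2 * 1 + 2 * 2) (rfl : 2 * 1 + 2 * 2 + 2 * 2 = 2 * 1 + 2 * (2 + 2))
    ⟨γ, hγ, hΞγ⟩ hνind
  rwa [← hνdef, add_sub_cancel_right] at h

/-- **The route's glue `RealMultiplicationGlue` from divisor correspondences** (item
stmt-HodgeConjecture-13681, `TwinSimilitudeAlgebraic → HodgeIsometryAlgebraic → TwinExists →
LefschetzOneOneK3 → RealMultiplicationSqrtTwoAlgebraic`), granted the named facts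
`Huybrechts_K3_marking_exists`, `Huybrechts_K3_hodgeTypes_H2`,
`Grothendieck1969_supportedClasses_le_hodgeConiveau` and the divisor-correspondence hypothesis (D):
Buskin's theorem, the universal twin and Lefschetz `(1,1)` are not needed.
[cite: Varesco2023, Thm. 2.1 and Rem. 2.2] [cite: Huybrechts2019, §1] -/
theorem realMultiplicationGlue_of_divisorCorrespondences
    (hmark : Huybrechts_K3_marking_exists) (hHT : Huybrechts_K3_hodgeTypes_H2)
    (hG : Grothendieck1969_supportedClasses_le_hodgeConiveau)
    (hD : ∀ (μ : OrientationFamily), μ.HasPoincareDuality →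
      ∀ (S : SchemeOver ℂ)
        (hS : (IsSmoothProjective 2 S ∧ Subsingleton (structureSheafCohomology S.left 1) ∧
          ∃ (A : HodgeModel 2 S) (η : MForm 𝓘(ℝ, A.model) A.carrier ℂ 2),
            IsHolomorphicInCharts η ∧ ∀ x, η x ≠ 0))
        (p : complexBetti S (2 * 2)),
        (IsIntegralClass p ∧ ∀ q : complexBetti S (2 * 2), IsIntegralClass q → ∃ n : ℤ, q = n • p) →
        ∀ a ∈ algebraicClasses S 1, ∀ b ∈ algebraicClasses S 1,
          ∃ γ ∈ algebraicClasses (S ⊗ S) 2, ∀ (x : complexBetti S (2 * 1)) (t : ℂ),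
            cupProduct (rfl : 2 * 1 + 2 * 1 = 2 * 2) x a = t • p →
              complexGysin μ (IsSmoothProjective.tensor_holds hS.1 hS.1) hS.1
                  (SemiCartesianMonoidalCategory.fst S S)
                  (rfl : 2 * 1 + 2 * 2 + 2 * 2 = 2 * 1 + 2 * (2 + 2))
                  (cupProduct (rfl : 2 * 1 + 2 * 2 = 2 * 1 + 2 * 2)
                    (complexBetti.map (SemiCartesianMonoidalCategory.snd S S) (2 * 1) x) γ) =
                t • b) :
    Theses.NikulinTwinTransport.RealMultiplicationGlue :=
  fun hX _ _ _ => realMultiplicationSqrtTwoAlgebraic_of_twinSimilitudeAlgebraic hX hmark hHT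
    (fun _ hS _ hd => isOfHodgeType_oneOne_of_mem_algebraicClasses hG hS hd) hD

/-- **The route's frame modulo `SquareGlue` and divisor correspondences** (assembly item
stmt-HodgeConjecture-13942, `TwinSimilitudeAlgebraic → HodgeIsometryAlgebraic → TwinExists →
LefschetzOneOneK3 → SectorComplement → HodgeConjecture`): granted the Künneth glue `SquareGlue`, the
three named facts and (D), the frame closes — of its hypotheses only X, Lefschetz `(1,1)` (consumed
by `SquareGlue`) and the sector complement are used. [cite: Varesco2023, Thm. 2.1 and Rem. 2.2] -/
theorem assembly_of_squareGlue_of_divisorCorrespondences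
    (hSq : Theses.NikulinTwinTransport.SquareGlue)
    (hmark : Huybrechts_K3_marking_exists) (hHT : Huybrechts_K3_hodgeTypes_H2)
    (hG : Grothendieck1969_supportedClasses_le_hodgeConiveau)
    (hD : ∀ (μ : OrientationFamily), μ.HasPoincareDuality →
      ∀ (S : SchemeOver ℂ)
        (hS : (IsSmoothProjective 2 S ∧ Subsingleton (structureSheafCohomology S.left 1) ∧
          ∃ (A : HodgeModel 2 S) (η : MForm 𝓘(ℝ, A.model) A.carrier ℂ 2),
            IsHolomorphicInCharts η ∧ ∀ x, η x ≠ 0))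
        (p : complexBetti S (2 * 2)),
        (IsIntegralClass p ∧ ∀ q : complexBetti S (2 * 2), IsIntegralClass q → ∃ n : ℤ, q = n • p) →
        ∀ a ∈ algebraicClasses S 1, ∀ b ∈ algebraicClasses S 1,
          ∃ γ ∈ algebraicClasses (S ⊗ S) 2, ∀ (x : complexBetti S (2 * 1)) (t : ℂ),
            cupProduct (rfl : 2 * 1 + 2 * 1 = 2 * 2) x a = t • p →
              complexGysin μ (IsSmoothProjective.tensor_holds hS.1 hS.1) hS.1
                  (SemiCartesianMonoidalCategory.fst S S)
                  (rfl : 2 * 1 + 2 * 2 + 2 * 2 = 2 * 1 + 2 * (2 + 2))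
                  (cupProduct (rfl : 2 * 1 + 2 * 2 = 2 * 1 + 2 * 2)
                    (complexBetti.map (SemiCartesianMonoidalCategory.snd S S) (2 * 1) x) γ) =
                t • b) :
    Theses.NikulinTwinTransport.Assembly :=
  fun hX _ _ h₁ h₇ => h₇ (hSq (realMultiplicationSqrtTwoAlgebraic_of_twinSimilitudeAlgebraic hX hmark hHT
    (fun _ hS _ hd => isOfHodgeType_oneOne_of_mem_algebraicClasses hG hS hd) hD) h₁)

end Summit.HodgeConjecture.HodgeConjecture.Theorems.NikulinTwinTransport

end
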